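import Summits.ValiantsHypothesis.ValiantsHypothesis.Theorems.KPlusLogSqLawTropicalBMarkedEdgeCoreSixCert2
import Summits.ValiantsHypothesis.ValiantsHypothesis.Theorems.KPlusLogSqLawTropicalBMarkedEdgeCoreSixCert3
import Summits.ValiantsHypothesis.ValiantsHypothesis.Theorems.KPlusLogSqLawTropicalBMarkedEdgeCoreSixCert4

/-!
# Route «KPlusLogSqLaw», crux `TropicalB` (stmt-ValiantsHypothesis-19771) — MARKED-EDGE sector, NESTED-TRIANGLE CORE on SIX nodes:
# case analysis, file 7

HONEST FRAMING.  Helper file (cell `pub-symmetroid`, seat val-sym-trop-p4 (g17), 2026-08-28; `--supports stmt-ValiantsHypothesis-19771 --as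
helper`).  Machine-generated (work/core6/gen) CASE ANALYSIS (cases_C/E/B of the base file, leaves = certificate lemmas) for the kernel version of the located-exact result «the nested-triangle
core {{1,2}},{{1,3}},{{2,3}},{{0,4}} is not realisable on 6 nodes» (memo LAYER2-CORE-g17.md §2b): each lemma takes two or three unique maximisers
(abstract presence `ok`, weights `w`; marked-edge slopes `g`, hypothesis `hg`) whose VALUES are the stated covers (`hv₁, hv₂, …`; `σ i` = the
image of node `i`; fixed points = marked loops) at weakly increasing parameters, and derives `False` from `factors_eq_fin` (p660322) with an
explicit re-factorisation of their arc multiset whose slope type majorises (or ties with different covers).  Nothing here concerns `TropicalB`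
in its window, `WeakLifting`, the doors, `MatrixDescartes` (stmt-ValiantsHypothesis-18050) or VP ≠ VNP.
-/

set_option linter.dupNamespace false
set_option linter.unusedSimpArgs false
set_option linter.unusedVariables false
set_option autoImplicit false

namespace Summit.ValiantsHypothesis.ValiantsHypothesis.Theorems.KPlusLogSqLaw
namespace MarkedEdge
namespace CoreSix

open Finset

/-- Case `σZ = 035142` of the six-node exclusion: no covers σC, σE, σB of patterns {1,3}, {2,3}, {1,2} complete it to four
unique maximisers (machine-generated case analysis over `cases_C/E/B`, each leaf a landed certificate lemma). -/
theorem caseZ6 (ok : Fin 6 → Fin 6 → Prop) (w g : Fin 6 → Fin 6 → ℤ)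
    (hg : ∀ i j : Fin 6, g i j = if i = j ∧ (i : ℕ) < 5 then (2 : ℤ) ^ (i : ℕ) else 0)
    {θB θC θE θZ : ℤ} (hBC : θB ≤ θC) (hBE : θB ≤ θE) (hBZ : θB ≤ θZ) (hCE : θC ≤ θE) (hCZ : θC ≤ θZ) (hEZ : θE ≤ θZ)
    {σB σC σE σZ : Equiv.Perm (Fin 6)}
    (hB : (∀ i, ok i (σB i)) ∧ ∀ τ : Equiv.Perm (Fin 6), τ ≠ σB → (∀ i, ok i (τ i)) →
      ∑ i, (w i (τ i) + θB * g i (τ i)) < ∑ i, (w i (σB i) + θB * g i (σB i)))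
    (hC : (∀ i, ok i (σC i)) ∧ ∀ τ : Equiv.Perm (Fin 6), τ ≠ σC → (∀ i, ok i (τ i)) →
      ∑ i, (w i (τ i) + θC * g i (τ i)) < ∑ i, (w i (σC i) + θC * g i (σC i)))
    (hE : (∀ i, ok i (σE i)) ∧ ∀ τ : Equiv.Perm (Fin 6), τ ≠ σE → (∀ i, ok i (τ i)) →
      ∑ i, (w i (τ i) + θE * g i (τ i)) < ∑ i, (w i (σE i) + θE * g i (σE i)))
    (hZ : (∀ i, ok i (σZ i)) ∧ ∀ τ : Equiv.Perm (Fin 6), τ ≠ σZ → (∀ i, ok i (τ i)) →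
      ∑ i, (w i (τ i) + θZ * g i (τ i)) < ∑ i, (w i (σZ i) + θZ * g i (σZ i)))
    (hB1 : σB 1 = 1) (hB2 : σB 2 = 2) (hB0 : σB 0 ≠ 0) (hB3 : σB 3 ≠ 3) (hB4 : σB 4 ≠ 4) (hC1 : σC 1 = 1) (hC3 : σC 3 = 3) (hC0 : σC 0 ≠ 0) (hC2 : σC 2 ≠ 2) (hC4 : σC 4 ≠ 4) (hE2 : σE 2 = 2) (hE3 : σE 3 = 3) (hE0 : σE 0 ≠ 0) (hE1 : σE 1 ≠ 1) (hE4 : σE 4 ≠ 4)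
    (hvZ : ∀ i, σZ i = (![0,3,5,1,4,2] : Fin 6 → Fin 6) i) : False := by
  rcases cases_C σC hC1 hC3 hC0 hC2 hC4 with ⟨a, b, c, d⟩ | ⟨a, b, c, d⟩ | ⟨a, b, c, d⟩ | ⟨a, b, c, d⟩ | ⟨a, b, c, d⟩ | ⟨a, b, c, d⟩ | ⟨a, b, c, d⟩ | ⟨a, b, c, d⟩ | ⟨a, b, c, d⟩ | ⟨a, b, c, d⟩ | ⟨a, b, c, d⟩
  · have hvC : ∀ i, σC i = (![2,1,0,3,5,4] : Fin 6 → Fin 6) i := by intro i; fin_cases i <;> simp [hC1, hC3, a, b, c, d]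
    clear a b c d
    exact pC0Z6 ok w g hg hC hZ hCZ hvC hvZ
  · have hvC : ∀ i, σC i = (![2,1,4,3,0,5] : Fin 6 → Fin 6) i := by intro i; fin_cases i <;> simp [hC1, hC3, a, b, c, d]
    clear a b c d
    exact pC1Z6 ok w g hg hC hZ hCZ hvC hvZ
  · have hvC : ∀ i, σC i = (![2,1,4,3,5,0] : Fin 6 → Fin 6) i := by intro i; fin_cases i <;> simp [hC1, hC3, a, b, c, d]
    clear a b c d
    exact pC2Z6 ok w g hg hC hZ hCZ hvC hvZ
  · have hvC : ∀ i, σC i = (![2,1,5,3,0,4] : Fin 6 → Fin 6) i := by intro i; fin_cases i <;> simp [hC1, hC3, a, b, c, d]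
    clear a b c d
    exact pC3Z6 ok w g hg hC hZ hCZ hvC hvZ
  · have hvC : ∀ i, σC i = (![4,1,0,3,2,5] : Fin 6 → Fin 6) i := by intro i; fin_cases i <;> simp [hC1, hC3, a, b, c, d]
    clear a b c d
    exact pC4Z6 ok w g hg hC hZ hCZ hvC hvZ
  · have hvC : ∀ i, σC i = (![4,1,0,3,5,2] : Fin 6 → Fin 6) i := by intro i; fin_cases i <;> simp [hC1, hC3, a, b, c, d]
    clear a b c d
    exact pC5Z6 ok w g hg hC hZ hCZ hvC hvZ
  · have hvC : ∀ i, σC i = (![4,1,5,3,0,2] : Fin 6 → Fin 6) i := by intro i; fin_cases i <;> simp [hC1, hC3, a, b, c, d]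
    clear a b c d
    exact pC6Z6 ok w g hg hC hZ hCZ hvC hvZ
  · have hvC : ∀ i, σC i = (![4,1,5,3,2,0] : Fin 6 → Fin 6) i := by intro i; fin_cases i <;> simp [hC1, hC3, a, b, c, d]
    clear a b c d
    exact pC7Z6 ok w g hg hC hZ hCZ hvC hvZ
  · have hvC : ∀ i, σC i = (![5,1,0,3,2,4] : Fin 6 → Fin 6) i := by intro i; fin_cases i <;> simp [hC1, hC3, a, b, c, d]
    clear a b c d
    exact pC8Z6 ok w g hg hC hZ hCZ hvC hvZ
  · have hvC : ∀ i, σC i = (![5,1,4,3,0,2] : Fin 6 → Fin 6) i := by intro i; fin_cases i <;> simp [hC1, hC3, a, b, c, d]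
    clear a b c d
    exact pC9Z6 ok w g hg hC hZ hCZ hvC hvZ
  · have hvC : ∀ i, σC i = (![5,1,4,3,2,0] : Fin 6 → Fin 6) i := by intro i; fin_cases i <;> simp [hC1, hC3, a, b, c, d]
    clear a b c d
    exact pC10Z6 ok w g hg hC hZ hCZ hvC hvZ

end CoreSix
end MarkedEdge
end Summit.ValiantsHypothesis.ValiantsHypothesis.Theorems.KPlusLogSqLaw
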